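import Summits.QuantumFields.BalabanUV.T4Continuum.Spine.BackgroundResolventTower
import Summits.QuantumFields.BalabanUV.T4Continuum.Support.KingPairingPlantedLaw

/-!
# T⁴ programme, spine node NE2 (U1a) — THE PERTURBED LAYER: the η → 0 limit WITH RATE `L^{−k}` of the unit-lattice covariance
# of EVERY relatively bounded, two-level consistent perturbation `Δ_a + tP` of Bałaban's free operator, on a fixed finite torus

Ninth generation of the NE2 prover lineage P1 of the cell `pub-balaban`, file 4 (assembly of files 1–3:
`Spine/BackgroundResolventLaw`, `Spine/BackgroundResolventTower`, `Support/KingPairingPlantedLaw`).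

THE RESULT.  Let `Δ_a^{(k)}` be Bałaban's operator (1.69)/(1.73) of [Balaban1984PropagatorsI] at lattice spacing `L^{−k}` on the
torus of `M` unit periods (`calDalev k`; `(Δ_a^{(k)})⁻¹ = 𝒢^{(k)}` = (1.83)), `Q_L` King's one-step block averaging (2.10) and
`J_k = L^{d/2}Q_Lᴴ` King's pairing.  Let `P_k` be ANY family of level operators with
 (H-bd)   `‖P_k𝒢^{(k)}‖ ≤ κ` and `‖𝒢^{(k)}P_k‖ ≤ κ` for all `k`;
 (H-cons) `‖𝒢^{(k+1)}(P_{k+1}J_k − J_kP_k)𝒢^{(k)}‖ ≤ C₂·L^{−k}` for all `k`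
(`BackgroundResolventTower.PerturbationLaws`).  Then for every coupling `t ∈ ℂ` with `‖t‖κ < 1` (§2):
 * `Δ_a^{(k)} + tP_k` is invertible at every level and **`towerLimitRate_perturbed_king`**: the King-averaged unit-lattice
   covariances `c_k(t) = (L^d)^k·Q^{(k)}(Δ_a^{(k)} + tP_k)⁻¹Q^{(k)ᴴ}` (`pertCov`) CONVERGE as `k → ∞`, with
   `‖c_k(t) − c_∞(t)‖ ≤ Cpert(t)·L^{−k}/(1 − L^{−1})`, `Cpert(t) = (CJ + ‖t‖C₂)(1 − ‖t‖κ)^{−2} + 2d·Cst·(1 − ‖t‖κ)^{−1}`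
   (`CJ = CQ + 4d·Cst` the `U = 1` planted-law constant) — generation 8's typed `U ≠ 1` wall `OneStepAveragedLaw`, sandwiched
   shape, DISCHARGED for these carriers (**`oneStepAveragedLaw_perturbed_king`**);
 * **`pertCov_sub_le`** / **`pertLimit_sub_le`**: `‖c_k(t) − c_k(0)‖, ‖c_∞(t) − c_∞(0)‖ ≤ ‖t‖κ·Cst·(1 − ‖t‖κ)^{−1}` — Lipschitz
   continuity in the background strength, uniformly in the lattice spacing and in the limit (the cell's NE2-LIP, operator norm);
 * at `t = 0` the tower IS King's `U = 1` tower of the lineage (`pertCov_zero`, `BalabanAveragedTowerUnit.towerLimitRate_Qavg`).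

WHAT THIS IS, HONESTLY (§3).  The background of [Balaban1985BackgroundPropagators] enters Bałaban's propagators through
`Δ_a(U) = Δ_U − ∂_UP_U∂_U* + aQ(U)*Q(U)` ((3.23)–(3.24)), i.e. as the perturbation `P(U) := Δ_a(U) − Δ_a(1)` of the free operator;
for a family of backgrounds `U_k` on the lattices `L^{−k}` (the cell's «canonical pairing», record `t4/T4-EST-U1a.md`) the
theorem above gives NE2⁺ — the η-rate of the background propagator's unit-lattice covariance — for the King-averaged `G_k(U_k)`
AS SOON AS (H-bd) and (H-cons) are verified for `P_k = P(U_k)`, with `κ` of the order of the background's size in a global gauge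
and `C₂` of the order of its first derivatives.  THOSE TWO INEQUALITIES ARE THE EXACT MISSING ESTIMATES of NE2⁺ on this route:
NOT IN PRINT (B5/B6/B9 print η-uniform bounds only, GAPS G-t4-U1a-1), typed here as `PerturbationLaws`, ASSERTED BY NOBODY;
their discharge for Bałaban's `P(U)` needs the covariant carriers `Δ_U`, `Q(U)` at two spacings (not in the tree) and is the
successor's work: (H-bd) is of the TYPE of the printed (1.89)/(3.42) uniform bounds (one derivative on `𝒢`), (H-cons) of the type
of the lineage's symbol rates (`∂^{η/L}` vs `∂^η`) plus the sampling error of a smooth connection.  Covariant (non-King)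
averagings `Q(U_k)` on the outside change `c_k(t)` by `O(‖Q(U_k) − Q‖) = O(size · L^{−k})` per step, summable — not treated here.

HONEST FRAMING (T4-DAG p. 1).  FIXED finite torus, linear (Gaussian) layer, operator-norm currency; background = abstract
perturbation (no covariant carrier constructed); every rate / pairing / constant OURS ([King1986] Lemma 4.5 (4.32)/(4.38) is the
scalar `A = 0` template); no conditional of the cell (`BetaPertH`, (B), (B^μ)) used or hidden; NOT infinite volume, NOT a mass
gap, NOT Clay, NOT summit progress; spine 0/9 unchanged (NE2 proper still needs (H-bd)/(H-cons) for Bałaban's carriers + the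
position-space currency).  HONEST DEPENDENCY: continuum YM on T⁴ ⇐ BetaPertH ∧ nine spine estimates (0/9 proved); BetaPertH ⇐
(D1) ∧ (D4) ∧ CAP+tail; G-an2-4 gates asym, D1 and NE2/3/4.  ABSOLUTE RULE kept; no `sorry`.
-/

noncomputable section

open scoped BigOperators ComplexConjugate Matrix Matrix.Norms.L2Operator
open Filter Topology

namespace Summit.QuantumFields.BalabanUV.T4Continuum.NE2PerturbedLayer

open Literature.MathematicalPhysics.QuantumFieldTheory.Balaban1983to89.B5Prop11Plancherel (Cst Cst_nonneg)
open Summit.QuantumFields.BalabanUV.T4Continuum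
open Summit.QuantumFields.BalabanUV.T4Continuum.CovariantAveragingTower (avgTow OneStepAveragedLaw TowerLimitRate)
open Summit.QuantumFields.BalabanUV.T4Continuum.BalabanAveragedTowerUnit (idx Qlev calGlev opNorm_Qlev_sq_le)
open Summit.QuantumFields.BalabanUV.T4Continuum.BackgroundResolventTower
open Summit.QuantumFields.BalabanUV.T4Continuum.KingPairingPlantedLaw

variable {d : ℕ} (L : ℕ) [NeZero L] (M : Fin d → ℕ) [hM : ∀ μ, NeZero (M μ)] (a : ℝ) (ha : 0 < a)

/-! ## §1 The `U = 1` tower laws HOLD (Bałaban's `Δ_a`, King's averaging and pairing) -/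

/-- **`FreeTowerLaws` AT `U = 1` — A THEOREM**: invertibility of `Δ_a^{(k)}`, `‖Q_L‖² ≤ L^{−d}`, `‖J_k‖ ≤ 1`, the exact pairing
`√(L^d)·Q_LJ_k = 1` (`F = 0`), the complement defect `2d·Cst·L^{−k}` and the injected defect `CJ·L^{−k}` (file 3).
[cite: Balaban1984PropagatorsI, (1.73) p.30, Prop. 1.1 (1.89) p.33; King1986, (2.10) p.653, p.664, Lemma 4.5 (4.38) p.674] [folklore] -/
theorem freeTowerLaws_king :
    FreeTowerLaws (calDalev L M a ha) (Qlev L M) (JpcT L M) (fun _ => 0) ((L : ℝ) ^ d)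
      (fun k => 2 * d * Cst d a * ((L : ℝ)⁻¹) ^ k) (fun k => CJ d a * ((L : ℝ)⁻¹) ^ k) (fun _ => 0) where
  isUnit_det := isUnit_det_calDalev L M a ha
  opNorm_A_sq_le := opNorm_Qlev_sq_le L M
  opNorm_J_le := opNorm_JpcT_le L M
  A_mul_J := sqrt_smul_Qlev_mul_JpcT L M
  opNorm_F_mul_inv_le := fun k => by rw [Matrix.zero_mul, norm_zero]
  opNorm_inv_mul_F_le := fun k => by rw [Matrix.conjTranspose_zero, Matrix.mul_zero, norm_zero]
  complement_le := complement_le_lev L M a ha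
  injected_le := injected_le_lev L M a ha

/-! ## §2 The perturbed tower: one-step law, limit with rate, Lipschitz in the coupling -/

/-- **THE PERTURBED UNIT-LATTICE COVARIANCE** at coupling `t`: `c_k(t) = (L^d)^k·Q^{(k)}(Δ_a^{(k)} + tP_k)⁻¹Q^{(k)ᴴ}` (King's
composite averaging `Q^{(k)}`).  For `P_k = Δ_a(U_k) − Δ_a` and `t = 1` this is the King-averaged background propagator
`G_k(U_k)` read on the unit lattice. [folklore] -/
def pertCov (P : (k : ℕ) → Matrix (idx L M k) (idx L M k) ℂ) (t : ℂ) (k : ℕ) : Matrix (idx L M 0) (idx L M 0) ℂ :=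
  avgTow (Qlev L M) ((L : ℝ) ^ d) (fun k => (calDalev L M a ha k + t • P k)⁻¹) k

/-- at `t = 0` the perturbed tower is the lineage's `U = 1` King tower `(L^d)^k·Q^{(k)}𝒢^{(k)}Q^{(k)ᴴ}`. [folklore] -/
theorem pertCov_zero (P : (k : ℕ) → Matrix (idx L M k) (idx L M k) ℂ) (k : ℕ) :
    pertCov L M a ha P 0 k = avgTow (Qlev L M) ((L : ℝ) ^ d) (calGlev L M a ha) k := by
  unfold pertCov
  congr 1
  funext j
  rw [zero_smul, add_zero, calDalev_inv]

/-- **THE PERTURBED ONE-STEP AVERAGED LAW HOLDS** for every perturbation family with `PerturbationLaws … κ e₂` and every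
`‖t‖κ < 1`: `OneStepAveragedLaw Q_L L^d (k ↦ (Δ_a^{(k)} + tP_k)⁻¹) (Epert κ (2dCst L^{−k}) (CJ L^{−k}) e₂ 0 t)` — generation 8's
typed `U ≠ 1` wall, sandwiched shape, discharged for these carriers. [folklore] -/
theorem oneStepAveragedLaw_perturbed_king {P : (k : ℕ) → Matrix (idx L M k) (idx L M k) ℂ} {κ : ℝ} {e₂ : ℕ → ℝ}
    (hpert : PerturbationLaws (calDalev L M a ha) P (JpcT L M) κ e₂) {t : ℂ} (ht : ‖t‖ * κ < 1) :
    OneStepAveragedLaw (Qlev L M) ((L : ℝ) ^ d) (fun k => (calDalev L M a ha k + t • P k)⁻¹)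
      (Epert κ (fun k => 2 * d * Cst d a * ((L : ℝ)⁻¹) ^ k) (fun k => CJ d a * ((L : ℝ)⁻¹) ^ k) e₂ (fun _ => 0) t) := by
  have hr : (0 : ℝ) < (L : ℝ) ^ d := pow_pos (by exact_mod_cast Nat.pos_of_ne_zero (NeZero.ne L)) d
  exact oneStepAveragedLaw_perturbed hr (freeTowerLaws_king L M a ha) hpert ht

/-- **NE2 AT A PERTURBED BACKGROUND — THE TOWER LIMIT WITH RATE** (`L ≥ 2`): for every perturbation family `P_k` with (H-bd)
`‖P_k𝒢^{(k)}‖, ‖𝒢^{(k)}P_k‖ ≤ κ` and (H-cons) `‖𝒢^{(k+1)}(P_{k+1}J_k − J_kP_k)𝒢^{(k)}‖ ≤ C₂L^{−k}`, and every coupling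
`‖t‖κ < 1`, the perturbed unit-lattice covariances CONVERGE with `‖c_k(t) − c_∞(t)‖ ≤ Cpert(t)·L^{−k}/(1 − L^{−1})`,
`Cpert(t) = (CJ + ‖t‖C₂)(1 − ‖t‖κ)^{−2} + 2d·Cst·(1 − ‖t‖κ)^{−1}`.  All orders in `t`; statement and constants OURS.
[cite: King1986, Lemma 4.5 (4.32)/(4.38) p.674 (scalar resolvent template); Balaban1984PropagatorsI, Prop. 1.1 (1.89) p.33;
Balaban1985BackgroundPropagators, (3.23)-(3.24) p.394 (where the background enters)] [folklore] -/
theorem towerLimitRate_perturbed_king (hL : 2 ≤ L) {P : (k : ℕ) → Matrix (idx L M k) (idx L M k) ℂ} {κ C₂ : ℝ}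
    (hpert : PerturbationLaws (calDalev L M a ha) P (JpcT L M) κ (fun k => C₂ * ((L : ℝ)⁻¹) ^ k)) {t : ℂ}
    (ht : ‖t‖ * κ < 1) :
    TowerLimitRate (Qlev L M) ((L : ℝ) ^ d) (fun k => (calDalev L M a ha k + t • P k)⁻¹)
      (Cpert κ (2 * d * Cst d a) (CJ d a) C₂ 0 t) ((L : ℝ)⁻¹) := by
  have hL1 : (1 : ℝ) < L := by exact_mod_cast (lt_of_lt_of_le one_lt_two hL : 1 < L)
  have hr : (0 : ℝ) < (L : ℝ) ^ d := pow_pos (lt_trans zero_lt_one hL1) d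
  refine towerLimitRate_perturbed hr (freeTowerLaws_king L M a ha) hpert (inv_lt_one_of_one_lt₀ hL1)
    (fun k => le_rfl) (fun k => le_rfl) (fun k => le_rfl) (fun k => ?_) ht
  simp only [zero_mul, le_refl]

/-- the same, unfolded on `pertCov`: existence of the limit and the explicit rate. [folklore] -/
theorem pertCov_tendsto (hL : 2 ≤ L) {P : (k : ℕ) → Matrix (idx L M k) (idx L M k) ℂ} {κ C₂ : ℝ}
    (hpert : PerturbationLaws (calDalev L M a ha) P (JpcT L M) κ (fun k => C₂ * ((L : ℝ)⁻¹) ^ k)) {t : ℂ}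
    (ht : ‖t‖ * κ < 1) :
    ∃ cinf : Matrix (idx L M 0) (idx L M 0) ℂ, Tendsto (pertCov L M a ha P t) atTop (𝓝 cinf) ∧
      ∀ k, ‖pertCov L M a ha P t k - cinf‖ ≤ Cpert κ (2 * d * Cst d a) (CJ d a) C₂ 0 t * ((L : ℝ)⁻¹) ^ k / (1 - (L : ℝ)⁻¹) :=
  towerLimitRate_perturbed_king L M a ha hL hpert ht

/-- **LIPSCHITZ IN THE COUPLING ALONG THE TOWER**: under (H-bd), `‖c_k(t) − c_k(0)‖ ≤ ‖t‖κ·Cst·(1 − ‖t‖κ)^{−1}` at every level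
(`‖𝒢^{(k)}‖ ≤ Cst`, (1.89) order zero). [cite: Balaban1984PropagatorsI, Prop. 1.1 (1.89) p.33; Balaban1985BackgroundPropagators,
Thm 3.4 p.400 (shape: analytic / Lipschitz dependence on the background at fixed spacing)] [folklore] -/
theorem pertCov_sub_le {P : (k : ℕ) → Matrix (idx L M k) (idx L M k) ℂ} {κ : ℝ} {e₂ : ℕ → ℝ}
    (hpert : PerturbationLaws (calDalev L M a ha) P (JpcT L M) κ e₂) {t : ℂ} (ht : ‖t‖ * κ < 1) (k : ℕ) :
    ‖pertCov L M a ha P t k - pertCov L M a ha P 0 k‖ ≤ ‖t‖ * κ * Cst d a * (1 - ‖t‖ * κ)⁻¹ := by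
  have hr : (0 : ℝ) < (L : ℝ) ^ d := pow_pos (by exact_mod_cast Nat.pos_of_ne_zero (NeZero.ne L)) d
  have hγ : ∀ k, ‖(calDalev L M a ha k)⁻¹‖ ≤ ((Cst d a)⁻¹)⁻¹ := fun k => by
    rw [inv_inv]; exact opNorm_inv_calDalev_le L M a ha k
  have h := opNorm_avgTow_perturbed_sub_le hr (opNorm_Qlev_sq_le L M) (isUnit_det_calDalev L M a ha) hγ
    hpert.opNorm_P_mul_inv_le hpert.opNorm_inv_mul_P_le ht k
  have e0 : pertCov L M a ha P 0 k = avgTow (Qlev L M) ((L : ℝ) ^ d) (fun k => (calDalev L M a ha k)⁻¹) k := by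
    unfold pertCov; congr 1; funext j; rw [zero_smul, add_zero]
  rw [e0]
  rw [inv_inv] at h
  exact h

/-- **… AND IN THE LIMIT**: `‖c_∞(t) − c_∞(0)‖ ≤ ‖t‖κ·Cst·(1 − ‖t‖κ)^{−1}` — background-Lipschitz continuity of the `η → 0`
limit covariance (operator norm; NE2-LIP). [folklore] -/
theorem pertLimit_sub_le {P : (k : ℕ) → Matrix (idx L M k) (idx L M k) ℂ} {κ : ℝ} {e₂ : ℕ → ℝ}
    (hpert : PerturbationLaws (calDalev L M a ha) P (JpcT L M) κ e₂) {t : ℂ}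
    (ht : ‖t‖ * κ < 1) {ct c0 : Matrix (idx L M 0) (idx L M 0) ℂ}
    (hct : Tendsto (pertCov L M a ha P t) atTop (𝓝 ct)) (hc0 : Tendsto (pertCov L M a ha P 0) atTop (𝓝 c0)) :
    ‖ct - c0‖ ≤ ‖t‖ * κ * Cst d a * (1 - ‖t‖ * κ)⁻¹ := by
  have hlim : Tendsto (fun k => pertCov L M a ha P t k - pertCov L M a ha P 0 k) atTop (𝓝 (ct - c0)) := hct.sub hc0
  have hn := (continuous_norm.tendsto _).comp hlim
  exact le_of_tendsto' hn fun k => pertCov_sub_le L M a ha hpert ht k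

/-! ## §3 The NE2⁺ reading: what is discharged and what is typed -/

/-- **NE2⁺ ON THE RESOLVENT ROUTE — THE REDUCTION BY NAME** (`L ≥ 2`): for every perturbation family of Bałaban's free operators
satisfying the two typed inequalities `PerturbationLaws` with geometric consistency, the η → 0 limit of the King-averaged
unit-lattice covariance of `(Δ_a + tP)⁻¹` EXISTS with rate `L^{−k}`, uniformly and Lipschitz-continuously on every closed sub-disc
`‖t‖ ≤ τ < κ⁻¹` of the Neumann disc.  What remains of NE2⁺ here is EXACTLY the verification of `PerturbationLaws` for
`P_k = Δ_a(U_k) − Δ_a` (covariant carriers at two spacings — not in the tree) and the position-space currency. [folklore] -/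
theorem ne2Plus_resolvent_route (hL : 2 ≤ L) {P : (k : ℕ) → Matrix (idx L M k) (idx L M k) ℂ} {κ C₂ : ℝ}
    (hpert : PerturbationLaws (calDalev L M a ha) P (JpcT L M) κ (fun k => C₂ * ((L : ℝ)⁻¹) ^ k)) {t : ℂ}
    (ht : ‖t‖ * κ < 1) :
    ∃ ct c0 : Matrix (idx L M 0) (idx L M 0) ℂ,
      Tendsto (pertCov L M a ha P t) atTop (𝓝 ct) ∧ Tendsto (pertCov L M a ha P 0) atTop (𝓝 c0) ∧
      (∀ k, ‖pertCov L M a ha P t k - ct‖ ≤ Cpert κ (2 * d * Cst d a) (CJ d a) C₂ 0 t * ((L : ℝ)⁻¹) ^ k / (1 - (L : ℝ)⁻¹)) ∧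
      ‖ct - c0‖ ≤ ‖t‖ * κ * Cst d a * (1 - ‖t‖ * κ)⁻¹ := by
  obtain ⟨ct, hct, hrate⟩ := pertCov_tendsto L M a ha hL hpert ht
  have h0 : ‖(0 : ℂ)‖ * κ < 1 := by rw [norm_zero, zero_mul]; exact zero_lt_one
  obtain ⟨c0, hc0, -⟩ := pertCov_tendsto L M a ha hL hpert h0
  exact ⟨ct, c0, hct, hc0, hrate, pertLimit_sub_le L M a ha hpert ht hct hc0⟩

end Summit.QuantumFields.BalabanUV.T4Continuum.NE2PerturbedLayer

end
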